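import Summits.PneNP.PneNP.Theorems.ExpanderLinearGeneratorsResKWidth
import HarnessLib

/-!
# The n-free resolution-size rung for expanding linear systems, I: the deterministic core

Support file for crux `stmt-PneNP-11442`
(`Summit.PneNP.PneNP.Theses.ExpanderLinearGenerators.ExpansionForcesDepthFregeSize`, the
EXPANSION-SCALE LAW: depth-`d` Frege proofs of the XOR-CNF of an unsolvable `ℓ`-sparse
`(r, 3ℓ/4)`-boundary expander have size `≥ 2^{r^ε}`, uniformly in the numbers `n` of variables and
`m` of rows). The law is stated n-FREE; for resolution the tree has the n-free WIDTH rung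
(`not_resDerivable_empty_of_rows`) and the n-DEPENDENT size rung (Ben-Sasson–Wigderson's
`exp(w²/n)`). This chain proves an n-free, m-free SIZE law for resolution:
`|π| ≥ r^{(1-ε)⌈3ℓ/4⌉} / 2^{ℓ+1}` (file III), by a load-bounded random restriction.

This file is the deterministic half. A partial assignment `ρ` of the variables `< n` has LOAD
`≤ L` on a row if it assigns at most `L` of the row's variables. If the loads on the rows whose
clauses a refutation `π` downloads are `≤ L < c`, then

* those rows form an `(r, c - L)`-boundary expander relative to the assigned set
  (`relExpander_of_loads`), whatever the VALUES of `ρ`;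
* hence, by the relative Ben-Sasson–Wigderson bound of the `Res(k)` chain
  (`ResKRestriction.not_resDerivable_empty_rel`) applied to the CNF of downloaded clauses, some
  line of `π` is NOT satisfied by `ρ` and keeps more than `W` unassigned literals, for every
  `W < (c - L) r / 2` (`exists_unsatisfied_wide_line`). (On variables `≥ n`, which no axiom
  mentions but weakenings may introduce, `ρ` is arbitrary; file III assigns them `false`.)

References: E. Ben-Sasson, A. Wigderson, J. ACM 48 (2001), §3 (restrictions), Thm. 6.5;
P. Beame, T. Pitassi, FOCS 1996 (restriction method for resolution size);
J. Krajíček, *Proof complexity* (CUP 2019), §13.4, Problem 19.4.5.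
-/

namespace Summit.PneNP.PneNP.Theorems.ResNFree

set_option linter.dupNamespace false -- `Summit.PneNP.PneNP.…`: summit = sub-problem (D-0017)

open Finset Literature.Computability.Complexity Literature.Computability.MetaComplexity
open Summit.PneNP.PneNP.Theorems.ResKRestriction

variable {m n : ℕ}

/-! ### Loads and relative expansion -/

/-- **Bounded loads give relative expansion.** If the row supports form an `(r, c)`-boundary
expander and `A` meets every row of `U` in at most `L` variables, then the rows of `U` form an
`(r, c - L)`-boundary expander relative to `A` (in the sense of `ResKRestriction.RelExpander`, with
the rows outside `U` excluded). [Ben-Sasson–Wigderson 2001, §3; Beame–Pitassi 1996] [folklore] -/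
theorem relExpander_of_loads (E : Fin m → LinEqMod 2 n) {r c : ℝ} {U : Finset (Fin m)}
    {A : Finset ℕ} {L : ℕ} (hexp : IsBoundaryExpander (rowVars E) r c)
    (hload : ∀ k ∈ U, ((rowVars E k) ∩ A).card ≤ L) :
    RelExpander E (univ \ U) A r (c - L) := by
  classical
  intro F hdisj hFr
  have hFU : F ⊆ U := by
    intro k hk
    by_contra hkU
    exact Finset.disjoint_left.1 hdisj (Finset.mem_sdiff.2 ⟨Finset.mem_univ _, hkU⟩) hk
  have h1 : c * F.card ≤ ((boundary (rowVars E) F).card : ℝ) := hexp F hFr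
  have hsub : (boundary (rowVars E) F) ∩ A ⊆ F.biUnion fun k => rowVars E k ∩ A := by
    intro v hv
    rw [Finset.mem_inter] at hv
    obtain ⟨k, hk, hvk⟩ := mem_cover.1 (boundary_subset_cover F hv.1)
    exact Finset.mem_biUnion.2 ⟨k, hk, Finset.mem_inter.2 ⟨hvk, hv.2⟩⟩
  have h2 : ((boundary (rowVars E) F) ∩ A).card ≤ L * F.card :=
    calc ((boundary (rowVars E) F) ∩ A).card
        ≤ (F.biUnion fun k => rowVars E k ∩ A).card := Finset.card_le_card hsub
      _ ≤ ∑ k ∈ F, (rowVars E k ∩ A).card := Finset.card_biUnion_le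
      _ ≤ ∑ k ∈ F, L := Finset.sum_le_sum fun k hk => hload k (hFU hk)
      _ = L * F.card := by rw [Finset.sum_const, smul_eq_mul, mul_comm]
  have h3 := Finset.card_sdiff_add_card_inter (boundary (rowVars E) F) A
  have h3' : (((boundary (rowVars E) F) \ A).card : ℝ)
      = (boundary (rowVars E) F).card - (((boundary (rowVars E) F) ∩ A).card : ℝ) := by
    have h := congrArg (fun x : ℕ => (x : ℝ)) h3
    push_cast at h
    linarith
  have h2' : ((((boundary (rowVars E) F) ∩ A).card : ℕ) : ℝ) ≤ (L : ℝ) * F.card := by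
    exact_mod_cast h2
  have h4 : (c - L) * F.card = c * F.card - L * F.card := by ring
  rw [h3', h4]
  linarith

/-! ### Clauses of one row -/

/-- A clause of the canonical CNF of row `k` has its variables in `rowVars E k` and is implied by
the equation of row `k`. [Ben-Sasson–Wigderson 2001, §4.2] [folklore] -/
theorem vars_imp_of_mem_equationCNF (E : Fin m → LinEqMod 2 n) (k : Fin m) {c : Clause ℕ}
    (hc : c ∈ equationCNF 1 (E k)) :
    (∀ l ∈ c.toFinset, l.1 ∈ rowVars E k) ∧
      ∀ σ : ℕ → Bool, (E k).Holds (blockVals 2 1 n σ) → finsetClauseEval σ c.toFinset := by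
  refine ⟨fun l hl => ?_, fun σ hσ => ?_⟩
  · have h1 := fst_mem_of_mem_canonicalCNF hc (List.mem_toFinset.1 hl)
    obtain ⟨i, hi, hv⟩ := mem_eqVars.1 h1
    rw [mem_encBlock] at hv
    obtain ⟨j, hj, hv⟩ := hv
    have : l.1 = i := by omega
    rw [this]
    exact val_mem_rowVars hi
  · have hev : (equationCNF 1 (E k)).eval σ = true := by
      rw [eval_equationCNF]; exact decide_eq_true hσ
    have hcl : c.any (Literal.eval σ) = true := (CNF.eval_eq_true_iff _ _).1 hev c hc
    obtain ⟨l, hl, e⟩ := List.any_eq_true.1 hcl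
    exact ⟨l, List.mem_toFinset.2 hl, e⟩

/-- **A restricted clause is implied by its row, relative to the restriction**: if row `k`
implies `C` and `ρ` does not satisfy `C`, then over assignments agreeing with `ρ` row `k` implies
`C|ρ` (a true literal of `C` cannot be an assigned one). [Ben-Sasson–Wigderson 2001, §3]
[folklore] -/
theorem rowsImplyRel_restrictClause (E : Fin m → LinEqMod 2 n) {k : Fin m}
    {C : Finset (Literal ℕ)}
    (himp : ∀ σ : ℕ → Bool, (E k).Holds (blockVals 2 1 n σ) → finsetClauseEval σ C)
    (ρ : ℕ → Option Bool) (hns : ¬ SatisfiedBy ρ C) :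
    RowsImplyRel E ρ {k} (restrictClause ρ C) := by
  intro σ hσρ hσ
  obtain ⟨l, hl, e⟩ := himp σ (hσ k (Finset.mem_singleton_self k))
  refine ⟨l, mem_restrictClause.2 ⟨hl, ?_⟩, e⟩
  cases hρl : ρ l.1 with
  | none => rfl
  | some b =>
    exfalso
    have hσl : σ l.1 = b := hσρ _ _ hρl
    have hb : b = l.2 := by
      simp [Literal.eval] at e
      rw [← hσl, e]
    exact hns ⟨l, hl, by rw [hρl, hb]⟩

/-! ### The CNF of downloaded clauses -/

/-- A refutation of `φ` is a refutation of the CNF consisting of the clauses it downloads.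
[folklore] -/
theorem isResRefutation_downloaded {φ : CNF ℕ} {π : List (ResLine ℕ)} (hπ : IsResRefutation φ π) :
    IsResRefutation ((π.filter fun l => l.rule = ResRule.initial).map fun l => l.clause.toList) π := by
  classical
  refine ⟨fun k hk => ?_, hπ.2⟩
  have hv := hπ.1 k hk
  rcases hl : (π[k]'hk).rule with _ | ⟨i, j, v⟩ | ⟨i⟩
  · simp only [IsValidResLine, hl] at hv ⊢
    simp only [CNF.clauseFinsets, List.mem_map, List.mem_filter, decide_eq_true_eq]
    exact ⟨(π[k]'hk).clause.toList, ⟨π[k]'hk, ⟨List.getElem_mem hk, hl⟩, rfl⟩,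
      Finset.toList_toFinset _⟩
  · simp only [IsValidResLine, hl] at hv ⊢
    exact hv
  · simp only [IsValidResLine, hl] at hv ⊢
    exact hv

/-- The clauses of the downloaded CNF are clauses of initial lines. [folklore] -/
theorem exists_line_of_mem_clauseSet_downloaded {π : List (ResLine ℕ)} {C : Finset (Literal ℕ)}
    (hC : C ∈ clauseSet ((π.filter fun l => l.rule = ResRule.initial).map fun l => l.clause.toList)) :
    ∃ l ∈ π, l.rule = ResRule.initial ∧ l.clause = C := by
  classical
  obtain ⟨c, hc, rfl⟩ := mem_clauseSet_iff.1 hC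
  simp only [List.mem_map, List.mem_filter, decide_eq_true_eq] at hc
  obtain ⟨l, ⟨hl, hrule⟩, rfl⟩ := hc
  exact ⟨l, hl, hrule, (Finset.toList_toFinset _).symm⟩

/-! ### The core: a load-bounded restriction leaves an unsatisfied wide line -/

/-- **Deterministic core of the restriction method, n-free form.** Let the row supports of `E`
form an `(r, c)`-boundary expander (`r ≥ 2`), let `π` be a resolution refutation of
`sumEncoding 1 E` each of whose initial lines downloads a clause of a row in `U`, and let `ρ`
assign, among the variables `< n`, only variables of a set `A` meeting every row of `U` in at most
`L < c` variables (its values, and its behaviour on variables `≥ n`, are arbitrary). Then for every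
`W < (c - L) r / 2` some line of `π` is not satisfied by `ρ` and has more than `W` literals left
unassigned.
[Ben-Sasson–Wigderson 2001, §3 and Thm. 6.5; Beame–Pitassi 1996] [folklore] -/
theorem exists_unsatisfied_wide_line (E : Fin m → LinEqMod 2 n) {r c : ℝ}
    (hexp : IsBoundaryExpander (rowVars E) r c) (hr : 2 ≤ r) {L W : ℕ} (hcL : (L : ℝ) < c)
    (hW : (W : ℝ) < (c - L) * r / 2) {π : List (ResLine ℕ)}
    (hπ : IsResRefutation (sumEncoding 1 E) π) {U : Finset (Fin m)}
    (hU : ∀ l ∈ π, l.rule = ResRule.initial →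
      ∃ k ∈ U, ∃ cl ∈ equationCNF 1 (E k), cl.toFinset = l.clause)
    {A : Finset ℕ} (hload : ∀ k ∈ U, ((rowVars E k) ∩ A).card ≤ L)
    (ρ : ℕ → Option Bool) (hρA : ∀ v, v < n → v ∉ A → ρ v = none) :
    ∃ l ∈ π, ¬ SatisfiedBy ρ l.clause ∧ W < (restrictClause ρ l.clause).card := by
  classical
  by_contra hcon
  push Not at hcon
  -- the refutation of the downloaded CNF, restricted by `ρ`, is narrow
  set φd : CNF ℕ := (π.filter fun l => l.rule = ResRule.initial).map fun l => l.clause.toList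
    with hφd
  have hπd : IsResRefutation φd π := isResRefutation_downloaded hπ
  have hD := resDerivable_restrict_of_isResRefutation hπd ρ (W := W) hcon
  -- the same restriction, undefined above `n`
  set ρ₀ : ℕ → Option Bool := fun v => if v < n then ρ v else none with hρ₀
  have hvars : ∀ C ∈ clauseSet φd, ∀ l ∈ C, l.1 < n := by
    intro C hC l hl
    obtain ⟨l₀, hl₀, hrule, rfl⟩ := exists_line_of_mem_clauseSet_downloaded hC
    obtain ⟨k, -, cl, hcl, hclC⟩ := hU l₀ hl₀ hrule
    rw [← hclC] at hl
    exact lt_of_mem_rowVars ((vars_imp_of_mem_equationCNF E k hcl).1 l hl)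
  have hagree : ∀ C ∈ clauseSet φd, ∀ l ∈ C, ρ₀ l.1 = ρ l.1 := by
    intro C hC l hl
    simp only [hρ₀, if_pos (hvars C hC l hl)]
  have hsubset : restrictFormula ρ (clauseSet φd) ⊆ restrictFormula ρ₀ (clauseSet φd) := by
    rintro C' ⟨C, hC, hns, rfl⟩
    refine ⟨C, hC, fun ⟨l, hl, hsat⟩ => hns ⟨l, hl, ?_⟩, ?_⟩
    · rwa [hagree C hC l hl] at hsat
    · ext l
      simp only [mem_restrictClause]
      constructor
      · rintro ⟨hl, h⟩; exact ⟨hl, by rw [← hagree C hC l hl]; exact h⟩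
      · rintro ⟨hl, h⟩; exact ⟨hl, by rw [hagree C hC l hl]; exact h⟩
  have hD₀ : ResDerivable (restrictFormula ρ₀ (clauseSet φd)) W ∅ := hD.mono_set hsubset
  -- relative expansion of the used rows, and the relative width bound
  have hrel : RelExpander E (univ \ U) A r (c - L) := relExpander_of_loads E hexp hload
  have hc' : (0 : ℝ) < c - L := by linarith
  have hρ₀A : ∀ v, v ∉ A → ρ₀ v = none := by
    intro v hv
    by_cases hvn : v < n
    · simp only [hρ₀, if_pos hvn]; exact hρA v hvn hv
    · simp only [hρ₀, if_neg hvn]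
  have hF : ∀ C' ∈ restrictFormula ρ₀ (clauseSet φd),
      ∃ k, k ∉ univ \ U ∧ RowsImplyRel E ρ₀ {k} C' := by
    rintro C' ⟨C, hC, hns, rfl⟩
    obtain ⟨l₀, hl₀, hrule, rfl⟩ := exists_line_of_mem_clauseSet_downloaded hC
    obtain ⟨k, hkU, cl, hcl, hclC⟩ := hU l₀ hl₀ hrule
    refine ⟨k, by simp [hkU], ?_⟩
    have himp := (vars_imp_of_mem_equationCNF E k hcl).2
    rw [hclC] at himp
    exact rowsImplyRel_restrictClause E himp ρ₀ hns
  exact not_resDerivable_empty_rel hrel hc' hr hρ₀A hF hW hD₀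

end Summit.PneNP.PneNP.Theorems.ResNFree
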